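import Mathlib
import HarnessLib
import HarnessLib.Audit
import Summits.RiemannHypothesis.Statement
import Literature.NumberTheory.LFunctions.WeilExplicit
import Literature.NumberTheory.LFunctions.RiemannXi
import Literature.NumberTheory.LFunctions.RiemannXiProofs
import Literature.Analysis.Complex.Hurwitz
import HarnessLib.Audit.Status.Attr

/-!
Route: ShiftedResolvent

CLOSED (refuted) 2026-08-29T21:52:23Z by gate — reason: refuted:stmt-RiemannHypothesis-15969 (ResolventRealZeros) by Summit.RiemannHypothesis.RiemannHypothesis.Theorems.not_ResolventRealZeros — note: repair grace of 72.0 h (deadline 2026-08-29T21:50:25Z) expired without a repair — closed by the gate. The file is kept as the record of this route; refuted decls are indexed as negative knowledge (`ledger negatives`).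

# Route ShiftedResolvent — RH by Hurwitz from shifted Weil resolvent vectors, real-rooted at every
cutoff (2001 swrh resurrected)

RESURRECT-2001 (archive `summits/rh/routes/shifted-weil-resolvent-hurwitz`, STATUS `proving`; its
Thm 1, Thm 3, row 17, §2(W) and Appendix A were referee-UPHELD as chain rows 2026-08-08; parked
harvest-only at the programme's stop). For a cutoff a > 0 and a SHIFT lam < ε(a) = weilGroundEnergy
a, the shifted-resolvent vector v_{a,lam} := (A_a − lam)⁻¹ 1 of Weil's truncated form (typed
operator-free: the L²-limit of minimising sequences of window test functions for the strictly convex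
functional J(g) = Re Q(g) − lam‖g‖² − 2 Re ĝ(1/2)) EXISTS UNCONDITIONALLY and its Mellin transform
has all its zeros on Re s = 1/2 (de Branges space H(E_{a,lam}) whose reproducing kernel is the
shifted resolvent; crux ResolventRealZeros). It therefore suffices to show X = ResolventConvergence
(2001 Statement (W♭)): along SOME cutoffs a_k → ∞ with SOME admissible shifts lam_k < ε(a_k),
normalised transforms c_k·v̂_k converge locally uniformly on U⁺ = {1/2 < Re s < 1} to a limit not
identically zero there and vanishing at every zero of ξ in U⁺. RH ⇒ X is the refereed converse (2001
App. A: lam_k = 0, limit Ξ♭ = product over the distinct zeros), so X is exactly RH-strength; X ⇒ RH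
is Hurwitz.
Lean: `∃ (a : ℕ → ℝ) (lam : ℕ → ℝ) (v : ℕ → ℝ → ℂ) (c : ℕ → ℂ) (F : ℂ → ℂ), Tendsto a atTop atTop ∧
(∀ k, 0 < a k ∧ lam k < Literature.NumberTheory.LFunctions.weilGroundEnergy (a k) ∧ c k ≠ 0 ∧ IsRes
(a k) (lam k) (v k)) ∧ TendstoLocallyUniformlyOn (fun k s => c k *
Literature.NumberTheory.LFunctions.weilMellin (v k) s) F atTop {s | 1/2 < s.re ∧ s.re < 1} ∧ (∃ s,
(1/2 < s.re ∧ s.re < 1) ∧ F s ≠ 0) ∧ (∀ s, 1/2 < s.re → s.re < 1 →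
Literature.NumberTheory.LFunctions.riemannXi s = 0 → F s = 0)` — with `IsRes a lam v` the inline
predicate spelled out in the crux blocks (item ResolventConvergence is the verbatim Prop;
Sketch.lean rc 0).

## Assembly
Pure logic plus Hurwitz over tree facts about ξ (Sketch.lean `closes`, kernel-checked rc 0;
glue.lean is the same theorem): take (a_k, lam_k, v_k, c_k, F) from ResolventConvergence;
ResolventRealZeros makes each F_k := c_k · weilMellin v_k entire and zero-free on U⁺ = {1/2 < Re s <
1}; Hurwitz (`Complex.hurwitz_eqOn_zero_or_forall_ne_zero`, U⁺ open convex) gives F ≡ 0 on U⁺ —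
excluded by the non-vanishing clause — or F zero-free on U⁺; since F vanishes at every zero of ξ in
U⁺, ξ has none there; by ξ(1 − s) = ξ(s) (`riemannXi_one_sub`) none in {0 < Re s < 1/2} either;
`riemannXi_eq_zero_of_nontrivial` + `riemannXi_eq_zero_iff_holds` turn Mathlib's RiemannHypothesis
binder into a zero of ξ in the open strip. Deciding theorem: `closes : ResolventConvergence →
ResolventRealZeros → Summit.RiemannHypothesis`.

Rationale: WHY THIS LINE. The hub's route WeilGroundState carries TWO open cruxes — GroundStateSimpleEven (∀ a:
bottom simple AND even; the 2001 programme priced evenness for all large a at RH ∧ a negative-moment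
hypothesis NM_B with no upper bound known in print, win-y3 RHworld / parity9 chain rows, while
simplicity holds only off a Lebesgue-null set of cutoffs, gsac LEMMA Z∅) and
GroundStatesConvergeToXi — because Connes–van Suijlekom Thm 6.1 (arXiv:2511.23257; in tree
`Connes2026_weilGroundState_zeros_re_eq_half_holds`) needs parity and simplicity. Shifting BELOW the
bottom removes both: for every a and every lam < ε(a) the form Q − lam‖·‖² is a positive definite
inner product on the form domain whose Fourier image is a regular de Branges space with the shifted
resolvent as kernel (2001 swrh Thm 1; printed sibling: Suzuki arXiv:2606.09096 Thm 1.5, the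
deficiency pencil of T_a = A_a − lam is real-rooted unconditionally "using only that finitely many
primes enter"), so the approximants exist and are real-rooted for free and the whole RH-content is
ONE convergence statement with a FREE shift parameter (lam_k ↑ ε(a_k) recovers ground-state
projections, 2001 Thm 3; lam_k = ε(a_k) − 1 is always admissible). Imports: de Branges / Kreĭn chain
theory of canonical systems (functional analysis) applied in the cutoff parameter; Hurwitz. Not in
the negatives index (empty for this summit at filing).

RANKED CRUXES. #2 ResolventConvergence (crux) — (W♭) There are cutoffs a_k → ∞, shifts lam_k <
weilGroundEnergy (a_k), constants c_k ≠ 0, shifted-resolvent vectors v_k (IsRes (a_k) (lam_k) (v_k))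
and F : ℂ → ℂ such that c_k · weilMellin (v_k) → F locally uniformly on U⁺ = {1/2 < Re s < 1}, F is
not identically zero on U⁺, and F(s) = 0 at every zero s ∈ U⁺ of riemannXi. Here IsRes a lam v :≡
MemLp v 2 ∧ ∃ window test functions g_n on [−a,a] with J(g_n) → m, m ≤ J(h) for every window test h,
and ∫‖g_n − v‖² → 0, J(g) = Re weilQuadratic g − lam·∫‖g‖² − 2·Re weilMellin g (1/2). [difficulty:
open-problem] (why it might fail: RH-strength by construction (with ResolventRealZeros it implies
RH): false under ¬RH; under RH any witness must have lam_k ≥ −20/1.29·e^{−5a_k/2} (2001 swrh (v)),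
so it hides an order law for ε along the sequence plus a shape statement both open in print (CCM25
§8).) [arXiv:2511.22755, arXiv:2606.09096, arXiv:2602.04022, arXiv:2511.23257, Bombieri2000Weil]
#3 ResolventRealZeros (crux) — For every a > 0, every lam < weilGroundEnergy a and every
shifted-resolvent vector v (IsRes a lam v as above), weilMellin v is entire and all its zeros lie on
Re s = 1/2 (the zeros of v̂(z) = weilMellin v (1/2 + iz) are real). 2001 swrh Thm 1(i) at w = 0
(real SIMPLE zeros; simplicity not asked here); printed sibling Suzuki 2026 Thm 1.5 (deficiency
pencil of A_a − lam real-rooted). [difficulty: L] (why it might fail: The de Branges axiom |E(z̄)| <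
|E(z)| for E_{a,lam} rests on positivity of Q − lam on the CLOSED form domain; as typed the
variational IsRes must pin v = (A_a−lam)⁻¹1 uniquely (strict lam < ε(a)); heavy H(E) input absent
from Mathlib.) [arXiv:2606.09096, arXiv:2301.00421, arXiv:2511.23257, arXiv:2511.22755]
#9 ResolventVectorExists (support) — For every a > 0 and lam < weilGroundEnergy a a
shifted-resolvent vector v exists (Lax–Milgram / Riesz on the completed form domain; minimising
sequences are L²-Cauchy by the parallelogram law because Q − lam‖·‖² ≥ (ε(a) − lam)‖·‖² on window
tests), and it is real-valued, even, with Re v̂(1/2) = ⟨(A_a − lam)⁻¹1, 1⟩ > 0. Supplies the objects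
the cruxes quantify over; provable now. [difficulty: provable-now] [Bombieri2000Weil,
arXiv:2511.22755, arXiv:2606.09096]
#9 ResolventConvergenceOfRH (support) — Calibration (RH ⇒ X): under RH take lam_k = 0 < ε(a_k) and
any a_k → ∞; the normalised resolvent transforms converge locally uniformly on ℂ to Ξ♭ (product over
the DISTINCT zeros), which vanishes at every zero of ξ (2001 swrh Appendix A, referee-upheld; cf.
2001 hl-x1 Prop 6.115 weak freezing). Documents that X is exactly RH-strength; not a hypothesis of
`closes`. [difficulty: L] [arXiv:2511.22755, arXiv:2606.09096]

TWO-LAYER PLAN. Foreseen once ResolventRealZeros closes: split ResolventConvergence ⇐ NonCollapse →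
ShapeOfNonCollapse → ResolventConvergence, where NonCollapse = "some admissible sequence (a_k,
lam_k) has L²-normalised resolvent vectors with visible mean |v̂_k(1/2)|/‖v_k‖₂ ≥ δ > 0" (carries
the RH-content: under ¬RH_fin Weil minimisers condense at the window walls and the centre empties,
2001 hl-t1 Thms A–G; under RH weak limits are c·ℱ⁻¹Ξ₀, 2001 hl-x1 Prop 6.115) and ShapeOfNonCollapse
= "non-collapse ⇒ a subsequence of normalised transforms converges on U⁺ to a nonzero limit
vanishing at the zeros of ξ". Also foreseen: the boundary case lam_k ↑ ε(a_k) as a separate child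
(ground-state PROJECTION kernels, 2001 Thm 3 = THEOREM RZ1, parity- and simplicity-free), linking to
route WeilGroundState's GroundStatesConvergeToXi as a sufficient condition.

KILL CRITERIA. (i) A refutation of ResolventRealZeros AS TYPED (e.g. a certified non-real zero of
v̂_{a,lam} for one small window by Galerkin + argument principle) forces a restatement on the
ground-state projection kernel (2001 Thm 3) or on Suzuki's deficiency pencil W(a,θ;z)
(arXiv:2606.09096 Thm 1.5); if those fail too the route closes refuted:ResolventRealZeros. (ii) A
proof that ResolventConvergence fails even under RH (contradicting 2001 App. A) closes the route.
(iii) Proof of route WeilGroundState's two open cruxes supersedes this route (close superseded);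
conversely a refutation of GroundStateSimpleEven there is NOT a kill here — it is the reason this
line exists.

NOT DECOMPOSED YET. No operator A_a, no de Branges space H(E), no canonical system is posited as a
Lean object at open (the cruxes are variational over the tree's IsWeilTest / weilQuadratic /
weilGroundEnergy / weilMellin); ResolventConvergence is not split into order-law × shape (see
Two-layer plan) until ResolventRealZeros lands; no rung at fixed windows; the real-SIMPLE-zeros and
exponential-type clauses of 2001 Thm 1 are not filed (not needed by `closes`); the witness-location
lemma lam_k ≥ −C e^{−5a_k/2} (2001 (v)) is a consequence, not an item.

CHEAPEST FALSIFIER. ONE kit job (not run this cycle): Galerkin blocks of the truncated Weil form in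
the trigonometric basis of arXiv:2106.01715 §2.2 (N ≈ 150) at a ∈ {0.3, 1.0, 1.5}, lam = ε_N(a) − 1;
solve (A_N − lam)v = 1, evaluate v̂ on a box [−40,40] × [0.05, 2] and count zeros by the argument
principle — any certified off-axis zero stable in N kills ResolventRealZeros as typed. Expected
outcome: none (2001 Thm 1 was re-derived blind by two referee seats; Suzuki 2026 Thm 1.5 proves the
pencil analogue unconditionally).

NUMBERS. ε(a) = weilGroundEnergy a is certified > 0 for x = e^{2a} ∈ [2, 26.6] with the ground state
even and simple there (2001 weil-positivity route, RESULTS-window; hub: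
weilPositivityOn_log_two_half_holds, ArchimedeanWindowSimpleEven proved); under RH log(1/ε(a)) ≥
4πe^{2a} − 9a − log a − O(1) (2001 win-y3 R4); any witness of X has lam_k ∈ [−C e^{−5a_k/2}, ε(a_k))
for large k with C = 20/I_Ξ, I_Ξ = (1/2π)∫|Ξ/Ξ(0)|² = 1.29… (2001 swrh (v)); small-window
asymptotics ε(a) = log(1/a) + μ₁ − log 2π − γ + O(a) (Suzuki 2026 Thm 1.4, proved in tree).

DEFINITION REQUESTS. `IsWeilResolventVector (a lam : ℝ) (v : ℝ → ℂ) : Prop` in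
Literature/NumberTheory/LFunctions (next to IsWeilGroundState): the inline predicate IsRes above,
with the API of WeilGroundState.lean (MemLp, a.e. localisation to the window, entire weilMellin,
uniqueness a.e. for lam < ε(a)); filed after open with --for the ResolventRealZeros item. Fact
wanted (cite): Suzuki arXiv:2606.09096 Thm 1.5 (deficiency pencil of A_a − lam real-rooted ∀ a, lam
< λ_a) and Cor 1.6. CONE NOTE (route-repair rrepair-RiemannHypothesis-ShiftedResol-28a347ee,
2026-08-16): needs-fact: NONE. The module cone's only unproved named fact,
`Literature.NumberTheory.LFunctions.WeilPositivity`, is the `@[conjecture]` [status: open] statement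
of Weil positivity, RH-equivalent in tree (`weil_criterion_holds : RiemannHypothesis ↔
WeilPositivity`, WeilCriterionProofs.lean), so it can never be discharged short of the summit and
must not be staffed as tier-0 debt. It rides in only because WeilExplicit.lean co-hosts it with the
vocabulary every item here is stated over (IsWeilTest, weilMellin, weilQuadratic, weilGroundEnergy);
no narrower module provides that vocabulary, so the import cannot be dropped, and the other three
imports (RiemannXi, RiemannXiProofs, Hurwitz — used by `closes`) carry no unproved facts. No item
and no line of `closes` names it: gate deps cone = 19 project constants, 0 unproved, staffable YES
(leaves: IsWeilTest, weilMellin, weilQuadratic, weilGroundEnergy, riemannXi, riemannXi_one_sub,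
riemannXi_eq_zero_of_nontrivial, riemannXi_eq_zero_iff_holds,
Complex.hurwitz_eqOn_zero_or_forall_ne_zero, Summit.RiemannHypothesis). The items are deliberately
NOT re-inlined over Mathlib primitives (as route SignCone did): hand-unfolding weilQuadratic /
weilGroundEnergy (digamma archimedean term, Λ-sum, sInf over the window sphere) inside three
RH-strength statements multiplies misstatement risk and severs them from the tree's weilGroundEnergy
/ IsWeilGroundState API while changing no real dependency. Same residual and same ruling as routes
WeilGroundState (rev 2), WeilComb (rev 5), SpectralTrace (g4) and WeilParity (2026-08-16), all
staffed with it. Operator-side fix, requested there as well: exempt `@[conjecture]` decls from the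
module-cone census (the gate's deps cone already ignores it), or move `WeilPositivity` with its
weil_criterion users into a leaf module importing WeilExplicit. What gates provers here is crux
vetting (0/2 at repair time), not the cone.

Novelty: Searches (2026-08-16): `lit search` local/hybrid index UNAVAILABLE all session (searchd connection
reset; retried ×4); `lit search --source arxiv "Suzuki Weil distribution screw function Riemann
hypothesis"` (2 hits: arXiv:2606.09096, arXiv:2209.04658); `--source s2 "Weil quadratic form screw
function de Branges Riemann hypothesis"` (2: arXiv:2606.09096, arXiv:2301.00421); `--source zbmath
"Weil quadratic form Riemann hypothesis de Branges"` (1: 2606.09096); `--source arxiv "Suzuki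
Hamiltonian de Branges zeta canonical system"` (1: arXiv:1204.1827); `--source openalex` (HTTP 429,
budget exhausted); `lit galaxy search "Weil quadratic form de Branges space" --star all` (0); `lit
galaxy search "Weil's positivity" --star all` (3, none relevant: Borwein et al. RH resource book,
Lapidus–van Frankenhuysen proceedings, Nakamura–Suzuki arXiv:2306.08317); `lit read
arxiv:2606.09096` pp. 1–6, 17–19 READ (Thms 1.1–1.5, Cor 1.6, §7.2); hub: 30 Theses read (nearest
WeilGroundState, WeilParity, WeilWindowFlow, SpectralTrace, PluckedString, IntegerScrew), 34 open +
107 closed card titles scanned, `ledger negatives` (0); 2001 archive: swrh paper + 18 reviews,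
real-zeros-ground-state brief, rh/SUMMIT.md, PLAN.md v3.1.
Nearest prior art found: arXiv:2606.09096 (Suzuki, June 2026) Thm 1.5 + Cor 1.6 — the deficiency
pencil W(a,θ;z) of T_a = A_a − lam (lam < λ_a) is real-rooted unconditionally for every a, and RH
follows from ONE limit formula e^{φ}W(a,θ;z) → z²ξ/ξ′(1/2 − iz); arXiv:2511.23257 (Co  [refs: 2606.09096, 2209.04658, 2301.00421, 1204.1827, 2306.08317, 2511.23257, 2602.04022, arxiv:2606.09096]

Barriers (technique_class: weil-positivity, de-branges-chain, hurwitz-limit): - technique_class: weil-positivity, de-branges-chain, hurwitz-limit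
- Literature.Barriers.RiemannHypothesis.DeBrangesPositivity: not engaged — de Branges SPACES enter
only as structure (H(E_{a,lam}) is a Hilbert space of entire functions for EVERY a and lam < ε(a)
because Q − lam is positive definite on the window by definition of ε(a)); no positivity axiom of de
Branges' 1986/1992 programme ((3.1), refuted by Conrey–Li at E = ξ(1 − iz)) is asserted, and the
structure functions here come from the truncated form, not from ξ.
- Literature.Barriers.RiemannHypothesis.NewmanConjecture: consistent — no margin is claimed
anywhere: the approximants are real-rooted at every cutoff whether or not RH holds, and the
RH-content sits entirely in the convergence crux, where a "barely true" statement must sit (any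
witness needs lam_k within e^{−5a_k/2} of 0 from below at large k).
- Literature.Barriers.RiemannHypothesis.BerryKeatingOperator: not engaged — no Hamiltonian with
'spectrum = zeros' is posited; zeros appear as Hurwitz limits of real zeros of transforms of
explicit L² vectors.
- Literature.Barriers.RiemannHypothesis.ScalingSystemCounting: not engaged — no Weyl-law /
level-counting identification is claimed.
- Literature.Barriers.RiemannHypothesis.PseudoLaplacianSpacing: not engaged — no automorphic
pseudo-Laplacian; the interval form is Weil's, the self-adjoint input is the Friedrichs realisation
on [−a, a].
- Negatives index: empty at filing (`ledger negatives --problem RiemannHyp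

History (route lifecycle, newest last):
- 2026-08-24T07:12:49Z · DORMANT — reconciler: no traction for 6.6 d (last activity item-evidence-added at 2026-08-17T16:49:38Z); parked, not closed — `ledger route dormant route-RiemannHypothesi (operator:999:4122542)
- 2026-08-26T21:50:25Z · BROKEN — ResolventRealZeros (stmt-RiemannHypothesis-15969, crux) refuted by Summit.RiemannHypothesis.RiemannHypothesis.Theorems.not_ResolventRealZeros (prover-rh-crit-cc-eng-1-g10-0)
- 2026-08-26T22:05:43Z · BROKEN — ResolventVectorExists (stmt-RiemannHypothesis-15970, support) refuted by Summit.RiemannHypothesis.RiemannHypothesis.Theorems.not_ResolventVectorExists (prover-rh-crit-cc-eng-1-g10-0)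
- 2026-08-29T21:52:23Z · CLOSED refuted — refuted:stmt-RiemannHypothesis-15969 (ResolventRealZeros) by Summit.RiemannHypothesis.RiemannHypothesis.Theorems.not_ResolventRealZeros (grace expired, auto-close) (gate)

sub-problem: RiemannHypothesis · status: closed(refuted) · opened planner-plan-lens-RiemannHypothesis-resurrect2001-v2-n1-0 2026-08-16T16:58:24Z · rev 2 · ledger route-RiemannHypothesis-ShiftedResolvent
GENERATED by the gate from the ledger (D-0016/17). Provers cite these decls: `theorem foo : Summit.RiemannHypothesis.RiemannHypothesis.Theses.ShiftedResolvent.<Decl> := …` in Summits/RiemannHypothesis/RiemannHypothesis/Theorems/<Name>.lean.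
-/

namespace Summit.RiemannHypothesis.RiemannHypothesis.Theses.ShiftedResolvent

open scoped BigOperators Topology Manifold Classical MeasureTheory ProbabilityTheory Matrix InnerProductSpace ComplexConjugate ContinuousMap
open Filter Set Function TopologicalSpace MeasureTheory

attribute [summit_statement] _root_.Summit.RiemannHypothesis

open Summit

/-- item stmt-RiemannHypothesis-15968 · crux · rank 2 · closed · moot by None · by planner
why it might fail: RH-strength by construction (with ResolventRealZeros it implies RH): false under ¬RH; under RH any witness must have lam_k ≥ −20/1.29·e^{−5a_k/2} (2001 swrh (v)), so it hides an order law for ε along the sequence plus a shape statement both open in print (CCM25 §8).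
sources: arXiv:2511.22755, arXiv:2606.09096, arXiv:2602.04022, arXiv:2511.23257, Bombieri2000Weil
[crux] (W♭) There are cutoffs a_k → ∞, shifts lam_k < weilGroundEnergy (a_k), constants c_k ≠ 0,
shifted-resolvent vectors v_k (IsRes (a_k) (lam_k) (v_k)) and F : ℂ → ℂ such that c_k · weilMellin
(v_k) → F locally uniformly on U⁺ = {1/2 < Re s < 1}, F is not identically zero on U⁺, and F(s) = 0
at every zero s ∈ U⁺ of riemannXi. Here IsRes a lam v :≡ MemLp v 2 ∧ ∃ window test functions g_n on
[−a,a] with J(g_n) → m, m ≤ J(h) for every window test h, and ∫‖g_n − v‖² → 0, J(g) = Re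
weilQuadratic g − lam·∫‖g‖² − 2·Re weilMellin g (1/2). [difficulty: open-problem] -/
@[route_item "route-RiemannHypothesis-ShiftedResolvent", crux]
def ResolventConvergence : Prop :=
  ∃ (a : ℕ → ℝ) (lam : ℕ → ℝ) (v : ℕ → ℝ → ℂ) (c : ℕ → ℂ) (F : ℂ → ℂ), Tendsto a atTop atTop ∧ (∀ k, 0 < a k ∧ lam k < Literature.NumberTheory.LFunctions.weilGroundEnergy (a k) ∧ c k ≠ 0 ∧ (MemLp (v k) 2 ∧ ∃ g : ℕ → ℝ → ℂ, (∀ n, Literature.NumberTheory.LFunctions.IsWeilTest (g n) ∧ tsupport (g n) ⊆ Icc (-(a k)) (a k)) ∧ (∃ m : ℝ, (∀ h : ℝ → ℂ, Literature.NumberTheory.LFunctions.IsWeilTest h → tsupport h ⊆ Icc (-(a k)) (a k) → m ≤ (Literature.NumberTheory.LFunctions.weilQuadratic h).re - lam k * ∫ t, ‖h t‖ ^ 2 - 2 * (Literature.NumberTheory.LFunctions.weilMellin h (1 / 2)).re) ∧ Tendsto (fun n => (Literature.NumberTheory.LFunctions.weilQuadratic (g n)).re - lam k * ∫ t, ‖g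 n t‖ ^ 2 - 2 * (Literature.NumberTheory.LFunctions.weilMellin (g n) (1 / 2)).re) atTop (𝓝 m)) ∧ Tendsto (fun n => ∫ t, ‖g n t - v k t‖ ^ 2) atTop (𝓝 0))) ∧ TendstoLocallyUniformlyOn (fun k s => c k * Literature.NumberTheory.LFunctions.weilMellin (v k) s) F atTop {s : ℂ | 1 / 2 < s.re ∧ s.re < 1} ∧ (∃ s : ℂ, (1 / 2 < s.re ∧ s.re < 1) ∧ F s ≠ 0) ∧ (∀ s : ℂ, 1 / 2 < s.re → s.re < 1 → Literature.NumberTheory.LFunctions.riemannXi s = 0 → F s = 0)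

/-- item stmt-RiemannHypothesis-15969 · crux · rank 3 · closed · refuted by Summit.RiemannHypothesis.RiemannHypothesis.Theorems.not_ResolventRealZeros (prover) · by planner
why it might fail: The de Branges axiom |E(z̄)| < |E(z)| for E_{a,lam} rests on positivity of Q − lam on the CLOSED form domain; as typed the variational IsRes must pin v = (A_a−lam)⁻¹1 uniquely (strict lam < ε(a)); heavy H(E) input absent from Mathlib.
sources: arXiv:2606.09096, arXiv:2301.00421, arXiv:2511.23257, arXiv:2511.22755
[crux] For every a > 0, every lam < weilGroundEnergy a and every shifted-resolvent vector v (IsRes a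
lam v as above), weilMellin v is entire and all its zeros lie on Re s = 1/2 (the zeros of v̂(z) =
weilMellin v (1/2 + iz) are real). 2001 swrh Thm 1(i) at w = 0 (real SIMPLE zeros; simplicity not
asked here); printed sibling Suzuki 2026 Thm 1.5 (deficiency pencil of A_a − lam real-rooted).
[difficulty: L] -/
@[route_item "route-RiemannHypothesis-ShiftedResolvent", crux]
def ResolventRealZeros : Prop :=
  ∀ a : ℝ, 0 < a → ∀ lam : ℝ, lam < Literature.NumberTheory.LFunctions.weilGroundEnergy a → ∀ v : ℝ → ℂ, (MemLp v 2 ∧ ∃ g : ℕ → ℝ → ℂ, (∀ n, Literature.NumberTheory.LFunctions.IsWeilTest (g n) ∧ tsupport (g n) ⊆ Icc (-a) a) ∧ (∃ m : ℝ, (∀ h : ℝ → ℂ, Literature.NumberTheory.LFunctions.IsWeilTest h → tsupport h ⊆ Icc (-a) a → m ≤ (Literature.NumberTheory.LFunctions.weilQuadratic h).re - lam * ∫ t, ‖h t‖ ^ 2 - 2 * (Literature.NumberTheory.LFunctions.weilMellin h (1 / 2)).re) ∧ Tendsto (fun n => (Literature.NumberTheory.LFunctions.weilQuadratic (g n)).re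 - lam * ∫ t, ‖g n t‖ ^ 2 - 2 * (Literature.NumberTheory.LFunctions.weilMellin (g n) (1 / 2)).re) atTop (𝓝 m)) ∧ Tendsto (fun n => ∫ t, ‖g n t - v t‖ ^ 2) atTop (𝓝 0)) → Differentiable ℂ (Literature.NumberTheory.LFunctions.weilMellin v) ∧ ∀ s : ℂ, Literature.NumberTheory.LFunctions.weilMellin v s = 0 → s.re = 1 / 2

/-- item stmt-RiemannHypothesis-15970 · support · rank 9 · closed · refuted by Summit.RiemannHypothesis.RiemannHypothesis.Theorems.not_ResolventVectorExists (prover) · by planner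
sources: Bombieri2000Weil, arXiv:2511.22755, arXiv:2606.09096
[support] For every a > 0 and lam < weilGroundEnergy a a shifted-resolvent vector v exists
(Lax–Milgram / Riesz on the completed form domain; minimising sequences are L²-Cauchy by the
parallelogram law because Q − lam‖·‖² ≥ (ε(a) − lam)‖·‖² on window tests), and it is real-valued,
even, with Re v̂(1/2) = ⟨(A_a − lam)⁻¹1, 1⟩ > 0. Supplies the objects the cruxes quantify over;
provable now. [difficulty: provable-now] -/
@[route_item "route-RiemannHypothesis-ShiftedResolvent"]
def ResolventVectorExists : Prop :=
  ∀ a : ℝ, 0 < a → ∀ lam : ℝ, lam < Literature.NumberTheory.LFunctions.weilGroundEnergy a → ∃ v : ℝ → ℂ, (MemLp v 2 ∧ ∃ g : ℕ → ℝ → ℂ, (∀ n, Literature.NumberTheory.LFunctions.IsWeilTest (g n) ∧ tsupport (g n) ⊆ Icc (-a) a) ∧ (∃ m : ℝ, (∀ h : ℝ → ℂ, Literature.NumberTheory.LFunctions.IsWeilTest h → tsupport h ⊆ Icc (-a) a → m ≤ (Literature.NumberTheory.LFunctions.weilQuadratic h).re - lam * ∫ t, ‖h t‖ ^ 2 - 2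 * (Literature.NumberTheory.LFunctions.weilMellin h (1 / 2)).re) ∧ Tendsto (fun n => (Literature.NumberTheory.LFunctions.weilQuadratic (g n)).re - lam * ∫ t, ‖g n t‖ ^ 2 - 2 * (Literature.NumberTheory.LFunctions.weilMellin (g n) (1 / 2)).re) atTop (𝓝 m)) ∧ Tendsto (fun n => ∫ t, ‖g n t - v t‖ ^ 2) atTop (𝓝 0)) ∧ (∀ t, (v t).im = 0 ∧ v (-t) = v t) ∧ 0 < (Literature.NumberTheory.LFunctions.weilMellin v (1 / 2)).re

/-- item stmt-RiemannHypothesis-15971 · support · rank 9 · closed · moot by None · by planner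
sources: arXiv:2511.22755, arXiv:2606.09096
[support] Calibration (RH ⇒ X): under RH take lam_k = 0 < ε(a_k) and any a_k → ∞; the normalised
resolvent transforms converge locally uniformly on ℂ to Ξ♭ (product over the DISTINCT zeros), which
vanishes at every zero of ξ (2001 swrh Appendix A, referee-upheld; cf. 2001 hl-x1 Prop 6.115 weak
freezing). Documents that X is exactly RH-strength; not a hypothesis of `closes`. [difficulty: L] -/
@[route_item "route-RiemannHypothesis-ShiftedResolvent"]
def ResolventConvergenceOfRH : Prop :=
  Summit.RiemannHypothesis → ResolventConvergence

/-- item stmt-RiemannHypothesis-15972 · assembly · rank 1 · closed · moot by None · by planner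
sources: arXiv:2511.23257, Bombieri2000Weil
[assembly] ResolventConvergence → ResolventRealZeros → Summit.RiemannHypothesis (the type of
`closes`; a prover closes it by `exact closes`). -/
@[route_item "route-RiemannHypothesis-ShiftedResolvent"]
def Assembly : Prop :=
  ResolventConvergence → ResolventRealZeros → Summit.RiemannHypothesis

/-! D-0027 §2.1 — DECIDING THEOREM (planner-authored via `route open/edit --closes-file`; by planner-plan-lens-RiemannHypothesis-resurrect2001-v2-n1-0 2026-08-16T16:58:24Z) — ARCHIVED: route closed (refuted) 2026-08-29T21:52:23Z; kept so importers keep building: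
its hypotheses are this route's items and its conclusion the sub-problem Statement (glue_lint), and it elaborates with this file. -/

/-- DECIDING THEOREM (D-0027 §2.1). Take `(a_k, lam_k, v_k, c_k, F)` from `ResolventConvergence`;
`ResolventRealZeros` makes each `F_k := c_k · weilMellin (v_k)` entire with all zeros on `Re s = 1/2`, hence
zero-free on `U⁺ := {1/2 < Re s < 1}`; `F_k → F` locally uniformly on `U⁺`; Hurwitz ⇒ `F ≡ 0` on `U⁺`
(excluded: `F s₀ ≠ 0` for some `s₀ ∈ U⁺`) or `F` is zero-free on `U⁺`; since `F` vanishes at every zero of `ξ`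
in `U⁺`, `ξ` has no zero there, and by `ξ(1-s) = ξ(s)` none in `{0 < Re s < 1/2}`; with
`riemannXi_eq_zero_iff_holds` every nontrivial zero of `ζ` has `Re s = 1/2`
(resurrects 2001 `summits/rh/routes/shifted-weil-resolvent-hurwitz`, step 2(W♭) + Hurwitz). -/
@[closes "route-RiemannHypothesis-ShiftedResolvent"] theorem closes (h₂ : ResolventConvergence) (h₃ : ResolventRealZeros) : _root_.Summit.RiemannHypothesis := by
  classical
  obtain ⟨a, lam, v, c, F, -, hk, hlim, ⟨s₀, hs₀U, hFs₀⟩, hvan⟩ := h₂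
  -- the approximants and their zeros
  have hF : ∀ k, Differentiable ℂ
      (fun s => c k * _root_.Literature.NumberTheory.LFunctions.weilMellin (v k) s) ∧
      ∀ s, c k * _root_.Literature.NumberTheory.LFunctions.weilMellin (v k) s = 0 → s.re = 1 / 2 := by
    intro k
    obtain ⟨hak, hlamk, hck, hres⟩ := hk k
    obtain ⟨hdiff, hzero⟩ := h₃ (a k) hak (lam k) hlamk (v k) hres
    refine ⟨(differentiable_const (c k)).mul hdiff, fun s hs => hzero s ?_⟩
    rcases mul_eq_zero.1 hs with h | h
    · exact absurd h hck
    · exact h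
  -- the right half of the open critical strip
  set U : Set ℂ := {s : ℂ | 1 / 2 < s.re ∧ s.re < 1} with hUdef
  have hUo : IsOpen U :=
    (isOpen_lt continuous_const Complex.continuous_re).inter (isOpen_lt Complex.continuous_re continuous_const)
  have hUc : Convex ℝ U := (convex_halfSpace_re_gt (1 / 2)).inter (convex_halfSpace_re_lt 1)
  have hFd : ∀ᶠ k in Filter.atTop, DifferentiableOn ℂ
      (fun s => c k * _root_.Literature.NumberTheory.LFunctions.weilMellin (v k) s) U :=
    Filter.Eventually.of_forall fun k => (hF k).1.differentiableOn
  have hFne : ∃ᶠ k in Filter.atTop, ∀ z ∈ U,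
      c k * _root_.Literature.NumberTheory.LFunctions.weilMellin (v k) z ≠ 0 :=
    Filter.Frequently.of_forall fun k z hz hz0 => by
      have := (hF k).2 z hz0
      linarith [hz.1]
  rcases Complex.hurwitz_eqOn_zero_or_forall_ne_zero hUo hUc.isPreconnected hFd hlim hFne with hzero | hne
  · -- `F ≡ 0` on `U` contradicts the non-vanishing clause
    exact absurd (hzero hs₀U) hFs₀
  · -- `F` is zero-free on `U`, and vanishes at the zeros of `ξ` there: so `ξ` has none
    show _root_.RiemannHypothesis
    intro s hzeta htriv hone
    have hxi := _root_.Literature.NumberTheory.LFunctions.riemannXi_eq_zero_of_nontrivial hzeta htriv hone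
    obtain ⟨-, h0, h1⟩ := (_root_.Literature.NumberTheory.LFunctions.riemannXi_eq_zero_iff_holds s).1 hxi
    by_contra hne'
    rcases lt_or_gt_of_ne hne' with hlt | hgt
    · have h1s : (1 - s) ∈ U := by
        refine ⟨?_, ?_⟩
        · simp only [Complex.sub_re, Complex.one_re]; linarith
        · simp only [Complex.sub_re, Complex.one_re]; linarith
      have hx1 : _root_.Literature.NumberTheory.LFunctions.riemannXi (1 - s) = 0 :=
        (_root_.Literature.NumberTheory.LFunctions.riemannXi_one_sub s).trans hxi
      exact hne (1 - s) h1s (hvan (1 - s) h1s.1 h1s.2 hx1)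
    · exact hne s ⟨hgt, h1⟩ (hvan s hgt h1 hxi)

end Summit.RiemannHypothesis.RiemannHypothesis.Theses.ShiftedResolvent
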